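import Summits.AtomisticToContinuum.HydrodynamicLimit.Theorems.ImplosionDichotomyPolynomialCompressionFrozenEnergyIdentity
import Summits.AtomisticToContinuum.HydrodynamicLimit.Theorems.ImplosionDichotomyPolynomialCompressionWeightTransport

/-!
# The relative-energy balance between hard-sphere Euler solutions with two equations of state

Helper file for the line `log-lipschitz-budget` of the crux
`ImplosionDichotomy.PolynomialCompression` (stub `stub_logBudgetShadowing`, level `0` of the
energy method: a hard-sphere solution with pressure `ρ θ ζ(ρ)`, `ζ = Z(· σ³)`, is compared with a
REFERENCE solution of a system with ANOTHER pressure law `ρ' θ' ζ₂(ρ')` — in the application the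
ideal gas, `ζ₂ ≡ 1`, `σ' = 0`). Consequences of the frozen-coefficient identity
`hsEuler_frozen_energy_identity` (`FrozenEnergyIdentity`), notation as there
(`γ = ζ + id·ζ'`, `A = θ γ(ρ)/ρ`, `B = 3ρ/(2θ)`, `e = ½ (A α² + ρ |w|² + B β²)`,
`Φᵢ = ½ (A uᵢ α² + ρ uᵢ |w|² + B uᵢ β²) + θ γ(ρ) α wᵢ + ρ ζ(ρ) β wᵢ`):

* `isSmoothSpaceTimeOn_frozenEnergy`, `isSmoothSpaceTimeOn_frozenFlux` — `e` and the `Φᵢ` are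
  jointly smooth on `[0, T) × 𝕋³` for jointly smooth `α, w, β` (to integrate the identity);
* `hsEuler_frozen_energy_identity_explicit` — for a solution whose pressure IS `ρ θ ζ(ρ)` the
  zero-order coefficients of the quadratic form `Q` are evaluated (`WeightTransport`:
  `hsEuler_weightA_transport`, `hsEuler_weightB_transport`, `hsEuler_coeffRho_partialDeriv`,
  `hsEuler_coeffTheta_partialDeriv`):
  `Q = ½ (A (2 - (2/3)ζ) - θ (2ζ' + ρζ'')) (div u) α² + ½ ((2/3) ζ B) (div u) β²
   + Σᵢ (∂ᵢθ γ + θ (2ζ' + ρζ'') ∂ᵢρ) α wᵢ + Σᵢ γ ∂ᵢρ β wᵢ`, every coefficient a zero-order quantity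
  times `div u`, `∇θ` or `∇ρ` (Type I);
* `hsEuler_relativeEnergy_balance_two_eos` — for `(α, w, β) = (ρ - ρ', u - u', θ - θ')` with
  `(ρ', u', θ')` a classical solution of the system with pressure `ρ' θ' ζ₂(ρ')` (`ζ₂` smooth on an
  open set containing the values of `ρ'`), the frozen operator of the difference is evaluated
  through the primitive equations of BOTH systems (`UniquenessPrimitive`):
  `F_ρ = -(α div u' + w·∇ρ')`, `F_uⱼ = -(w·∇u'ⱼ + (θγ(ρ)/ρ - θ'γ₂(ρ')/ρ') ∂ⱼρ' + (ζ(ρ) - ζ₂(ρ')) ∂ⱼθ')`,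
  `F_θ = -(w·∇θ' + (2/3)(θζ(ρ) - θ'ζ₂(ρ')) div u')`: bilinear in the differences and the
  reference gradients, with the equation-of-state defects `θγ(ρ)/ρ - θ'γ₂(ρ')/ρ'`,
  `ζ(ρ) - ζ₂(ρ')`, `θζ(ρ) - θ'ζ₂(ρ')` as the only forcing. No derivative of `α, w, β` and no time
  derivative of the reference solution survives. For `σ' = σ`, `ζ₂ = ζ` this is a rearrangement
  of `hsEuler_relativeEnergy_balance` (`UniquenessIdentity`).
-/

noncomputable section

namespace Summit.AtomisticToContinuum.HydrodynamicLimit.Theorems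

open Set Filter Topology MeasureTheory
open scoped ContDiff
open Literature.MathematicalPhysics.KineticTheory Literature.Analysis.FunctionSpaces

section Explicit

variable {σ T : ℝ} {ρ θ : ℝ → T3 → ℝ} {u : ℝ → T3 → V3} {ζ : ℝ → ℝ} {J : Set ℝ}
  {α β : ℝ → T3 → ℝ} {w : ℝ → T3 → V3}

/-- The energy density `e = ½ (A α² + ρ |w|² + B β²)` of the frozen-coefficient identity is
jointly smooth on `[0, T) × 𝕋³` for jointly smooth `α, w, β` (to differentiate `∫ e` in time).
[folklore] -/
theorem isSmoothSpaceTimeOn_frozenEnergy (hE : IsHardSphereEulerSolution σ T ρ u θ)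
    (hJ : IsOpen J) (hζ : ContDiffOn ℝ ∞ ζ J) (hρJ : ∀ t ∈ Ico 0 T, ∀ x, ρ t x ∈ J)
    (hα : Torus.IsSmoothSpaceTimeOn (Ico 0 T) α) (hw : Torus.IsSmoothSpaceTimeOn (Ico 0 T) w)
    (hβ : Torus.IsSmoothSpaceTimeOn (Ico 0 T) β) :
    Torus.IsSmoothSpaceTimeOn (Ico 0 T) (fun s y => 1 / 2 *
        (θ s y * (ζ (ρ s y) + ρ s y * deriv ζ (ρ s y)) / ρ s y * α s y ^ 2 +
          ρ s y * ‖w s y‖ ^ 2 + 3 / 2 * ρ s y / θ s y * β s y ^ 2)) := by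
  have hal2 : Torus.IsSmoothSpaceTimeOn (Ico 0 T) (fun t x => α t x ^ 2) := hα.pow 2
  have hbe2 : Torus.IsSmoothSpaceTimeOn (Ico 0 T) (fun t x => β t x ^ 2) := hβ.pow 2
  have hw2 : Torus.IsSmoothSpaceTimeOn (Ico 0 T) (fun t x => ‖w t x‖ ^ 2) := hw.norm_sq ℝ
  have hhalf : Torus.IsSmoothSpaceTimeOn (Ico 0 T) (fun (_ : ℝ) (_ : T3) => (1 / 2 : ℝ)) :=
    Torus.isSmoothSpaceTimeOn_const (Torus.isSmooth_const _) _
  exact hhalf.mul ((((isSmoothSpaceTimeOn_weightA hE hJ hζ hρJ).mul hal2).add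
    (hE.smooth_density.mul hw2)).add ((isSmoothSpaceTimeOn_weightB hE).mul hbe2))

/-- The fluxes `Φᵢ = ½ (A uᵢ α² + ρ uᵢ |w|² + B uᵢ β²) + θ γ(ρ) α wᵢ + ρ ζ(ρ) β wᵢ` of the
frozen-coefficient identity are jointly smooth on `[0, T) × 𝕋³` for jointly smooth `α, w, β`
(so that `∫ Σᵢ ∂ᵢΦᵢ = 0` on every time slice). [folklore] -/
theorem isSmoothSpaceTimeOn_frozenFlux (hE : IsHardSphereEulerSolution σ T ρ u θ)
    (hJ : IsOpen J) (hζ : ContDiffOn ℝ ∞ ζ J) (hρJ : ∀ t ∈ Ico 0 T, ∀ x, ρ t x ∈ J)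
    (hα : Torus.IsSmoothSpaceTimeOn (Ico 0 T) α) (hw : Torus.IsSmoothSpaceTimeOn (Ico 0 T) w)
    (hβ : Torus.IsSmoothSpaceTimeOn (Ico 0 T) β) (i : Fin 3) :
    Torus.IsSmoothSpaceTimeOn (Ico 0 T) (fun t y =>
      1 / 2 * (θ t y * (ζ (ρ t y) + ρ t y * deriv ζ (ρ t y)) / ρ t y * u t y i * α t y ^ 2 +
          ρ t y * u t y i * ‖w t y‖ ^ 2 +
          3 / 2 * ρ t y / θ t y * u t y i * β t y ^ 2) +
        θ t y * (ζ (ρ t y) + ρ t y * deriv ζ (ρ t y)) * α t y * w t y i +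
        ρ t y * ζ (ρ t y) * β t y * w t y i) := by
  have hρ := hE.smooth_density
  have hu := hE.smooth_velocity
  have hζρ := isSmoothSpaceTimeOn_comp_density hρ hζ hρJ
  have hζdρ := isSmoothSpaceTimeOn_comp_density hρ (hζ.deriv_of_isOpen (m := ∞) hJ le_rfl) hρJ
  have hγf : Torus.IsSmoothSpaceTimeOn (Ico 0 T)
      (fun s y => ζ (ρ s y) + ρ s y * deriv ζ (ρ s y)) := hζρ.add (hρ.mul hζdρ)
  have hal2 : Torus.IsSmoothSpaceTimeOn (Ico 0 T) (fun t x => α t x ^ 2) := hα.pow 2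
  have hbe2 : Torus.IsSmoothSpaceTimeOn (Ico 0 T) (fun t x => β t x ^ 2) := hβ.pow 2
  have hw2 : Torus.IsSmoothSpaceTimeOn (Ico 0 T) (fun t x => ‖w t x‖ ^ 2) := hw.norm_sq ℝ
  have hhalf : Torus.IsSmoothSpaceTimeOn (Ico 0 T) (fun (_ : ℝ) (_ : T3) => (1 / 2 : ℝ)) :=
    Torus.isSmoothSpaceTimeOn_const (Torus.isSmooth_const _) _
  exact ((hhalf.mul (((((isSmoothSpaceTimeOn_weightA hE hJ hζ hρJ).mul (hu.apply i)).mul hal2).add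
    ((hρ.mul (hu.apply i)).mul hw2)).add (((isSmoothSpaceTimeOn_weightB hE).mul (hu.apply i)).mul
      hbe2))).add (((hE.smooth_temperature.mul hγf).mul hα).mul (hw.apply i))).add
    (((hρ.mul hζρ).mul hβ).mul (hw.apply i))

/-- **The frozen-coefficient energy identity with zero-order coefficients.** The identity
`hsEuler_frozen_energy_identity` for a classical solution whose pressure IS `ρ θ ζ(ρ)`, with the
transport coefficients of the weights and the cross coefficients evaluated (`WeightTransport`:
`hsEuler_weightA_transport`, `hsEuler_weightB_transport`, `hsEuler_coeffRho_partialDeriv`,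
`hsEuler_coeffTheta_partialDeriv`): `∂ₜe + Σᵢ ∂ᵢΦᵢ = Q + A α F_ρ + ρ Σⱼ wⱼ F_uⱼ + B β F_θ` with
`Q = ½ (A (2 - (2/3) ζ) - θ (2ζ' + ρ ζ'')) (div u) α² + ½ ((2/3) ζ B) (div u) β²
 + Σᵢ (∂ᵢθ γ + θ (2ζ' + ρ ζ'') ∂ᵢρ) α wᵢ + Σᵢ γ ∂ᵢρ β wᵢ` (`ζ, ζ', ζ''` at `ρ`, `γ = ζ + ρ ζ'`):
every coefficient of the quadratic form is a zero-order quantity times `div u`, `∇θ` or `∇ρ`.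
[folklore] -/
theorem hsEuler_frozen_energy_identity_explicit (hE : IsHardSphereEulerSolution σ T ρ u θ)
    (hJ : IsOpen J) (hζ : ContDiffOn ℝ ∞ ζ J) (hρJ : ∀ t ∈ Ico 0 T, ∀ x, ρ t x ∈ J)
    (hp : ∀ t ∈ Ico 0 T, ∀ x, hsPressure σ (ρ t x) (θ t x) = ρ t x * θ t x * ζ (ρ t x))
    (hα : Torus.IsSmoothSpaceTimeOn (Ico 0 T) α) (hw : Torus.IsSmoothSpaceTimeOn (Ico 0 T) w)
    (hβ : Torus.IsSmoothSpaceTimeOn (Ico 0 T) β) {t : ℝ} (ht : t ∈ Ico 0 T) (x : T3) :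
    Torus.timeDerivWithin (Ico 0 T) (fun s y => 1 / 2 *
        (θ s y * (ζ (ρ s y) + ρ s y * deriv ζ (ρ s y)) / ρ s y * α s y ^ 2 +
          ρ s y * ‖w s y‖ ^ 2 + 3 / 2 * ρ s y / θ s y * β s y ^ 2)) t x +
      ∑ i, Torus.partialDeriv i (fun y =>
        1 / 2 * (θ t y * (ζ (ρ t y) + ρ t y * deriv ζ (ρ t y)) / ρ t y * u t y i * α t y ^ 2 +
            ρ t y * u t y i * ‖w t y‖ ^ 2 +
            3 / 2 * ρ t y / θ t y * u t y i * β t y ^ 2) +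
          θ t y * (ζ (ρ t y) + ρ t y * deriv ζ (ρ t y)) * α t y * w t y i +
          ρ t y * ζ (ρ t y) * β t y * w t y i) x =
      1 / 2 * ((θ t x * (ζ (ρ t x) + ρ t x * deriv ζ (ρ t x)) / ρ t x * (2 - 2 / 3 * ζ (ρ t x)) -
            θ t x * (2 * deriv ζ (ρ t x) + ρ t x * deriv (deriv ζ) (ρ t x))) *
          ∑ i, Torus.partialDeriv i (fun y => u t y i) x) * α t x ^ 2 +
      1 / 2 * (2 / 3 * ζ (ρ t x) * (3 / 2 * ρ t x / θ t x) *
          ∑ i, Torus.partialDeriv i (fun y => u t y i) x) * β t x ^ 2 +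
      ∑ i, (Torus.partialDeriv i (θ t) x * (ζ (ρ t x) + ρ t x * deriv ζ (ρ t x)) +
            θ t x * (2 * deriv ζ (ρ t x) + ρ t x * deriv (deriv ζ) (ρ t x)) *
              Torus.partialDeriv i (ρ t) x) * α t x * w t x i +
      ∑ i, (ζ (ρ t x) + ρ t x * deriv ζ (ρ t x)) * Torus.partialDeriv i (ρ t) x * β t x * w t x i +
      θ t x * (ζ (ρ t x) + ρ t x * deriv ζ (ρ t x)) / ρ t x * α t x *
        (Torus.timeDerivWithin (Ico 0 T) α t x + ∑ i, u t x i * Torus.partialDeriv i (α t) x +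
          ρ t x * ∑ i, Torus.partialDeriv i (fun y => w t y i) x) +
      ρ t x * ∑ j, w t x j *
        (Torus.timeDerivWithin (Ico 0 T) (fun s y => w s y j) t x +
          ∑ i, u t x i * Torus.partialDeriv i (fun y => w t y j) x +
          θ t x * (ζ (ρ t x) + ρ t x * deriv ζ (ρ t x)) / ρ t x * Torus.partialDeriv j (α t) x +
          ζ (ρ t x) * Torus.partialDeriv j (β t) x) +
      3 / 2 * ρ t x / θ t x * β t x *
        (Torus.timeDerivWithin (Ico 0 T) β t x + ∑ i, u t x i * Torus.partialDeriv i (β t) x +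
          2 / 3 * (θ t x * ζ (ρ t x)) * ∑ i, Torus.partialDeriv i (fun y => w t y i) x) := by
  rw [hsEuler_frozen_energy_identity hE hJ hζ hρJ hα hw hβ ht x,
    hsEuler_weightA_transport hE hJ hζ hρJ hp ht x, hsEuler_weightB_transport hE hJ hζ hρJ hp ht x]
  simp only [hsEuler_coeffRho_partialDeriv hE hJ hζ hρJ ht x,
    hsEuler_coeffTheta_partialDeriv hE hJ hζ hρJ ht x]

end Explicit

section TwoEos

/-- **Relative-energy balance between solutions of two hard-sphere Euler systems (two equations
of state), pointwise.** Let `(ρ, u, θ)` solve the system with pressure `ρ θ ζ(ρ)` and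
`(ρ', u', θ')` the system with (possibly different `σ'` and) pressure `ρ' θ' ζ₂(ρ')`, `ζ, ζ₂`
smooth on open sets containing the values of `ρ, ρ'`. With the weights, energy density and fluxes
of `hsEuler_frozen_energy_identity` built from the FIRST solution and applied to
`(α, w, β) = (ρ - ρ', u - u', θ - θ')`:
`∂ₜe + Σᵢ ∂ᵢΦᵢ = Q + A α F_ρ + ρ Σⱼ wⱼ F_uⱼ + B β F_θ` with `Q` as in
`hsEuler_frozen_energy_identity_explicit` and the frozen operator of the difference EVALUATED
through both systems: `F_ρ = -(α div u' + w·∇ρ')`,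
`F_uⱼ = -(w·∇u'ⱼ + (θ γ(ρ)/ρ - θ' γ₂(ρ')/ρ') ∂ⱼρ' + (ζ(ρ) - ζ₂(ρ')) ∂ⱼθ')`,
`F_θ = -(w·∇θ' + (2/3)(θ ζ(ρ) - θ' ζ₂(ρ')) div u')` (`γ = ζ + id·ζ'`, `γ₂ = ζ₂ + id·ζ₂'`):
bilinear in the differences and the reference gradients `∇ρ', ∇u', ∇θ'`, plus the
equation-of-state defects `θγ(ρ)/ρ - θ'γ₂(ρ')/ρ'`, `ζ(ρ) - ζ₂(ρ')`, `θζ(ρ) - θ'ζ₂(ρ')` (for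
`ζ₂ = ζ` these are again small and one recovers `hsEuler_relativeEnergy_balance`; for the ideal
gas `ζ₂ ≡ 1` they are the `O(ρσ³)` forcing of the shadowing estimate). [folklore] -/
theorem hsEuler_relativeEnergy_balance_two_eos :
    ∀ {σ σ' T : ℝ} {ρ θ ρ' θ' : ℝ → T3 → ℝ} {u u' : ℝ → T3 → V3} {ζ ζ₂ : ℝ → ℝ} {J J₂ : Set ℝ},
    IsHardSphereEulerSolution σ T ρ u θ → IsHardSphereEulerSolution σ' T ρ' u' θ' →
    IsOpen J → IsOpen J₂ → ContDiffOn ℝ (⊤ : ℕ∞) ζ J → ContDiffOn ℝ (⊤ : ℕ∞) ζ₂ J₂ →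
    (∀ t ∈ Ico 0 T, ∀ x, ρ t x ∈ J) → (∀ t ∈ Ico 0 T, ∀ x, ρ' t x ∈ J₂) →
    (∀ t ∈ Ico 0 T, ∀ x, hsPressure σ (ρ t x) (θ t x) = ρ t x * θ t x * ζ (ρ t x)) →
    (∀ t ∈ Ico 0 T, ∀ x, hsPressure σ' (ρ' t x) (θ' t x) = ρ' t x * θ' t x * ζ₂ (ρ' t x)) →
    ∀ {t : ℝ}, t ∈ Ico 0 T → ∀ x : T3,
    Torus.timeDerivWithin (Ico 0 T) (fun s y => 1 / 2 *
        (θ s y * (ζ (ρ s y) + ρ s y * deriv ζ (ρ s y)) / ρ s y * (ρ s y - ρ' s y) ^ 2 +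
          ρ s y * ‖u s y - u' s y‖ ^ 2 + 3 / 2 * ρ s y / θ s y * (θ s y - θ' s y) ^ 2)) t x +
      ∑ i, Torus.partialDeriv i (fun y =>
        1 / 2 * (θ t y * (ζ (ρ t y) + ρ t y * deriv ζ (ρ t y)) / ρ t y * u t y i *
              (ρ t y - ρ' t y) ^ 2 +
            ρ t y * u t y i * ‖u t y - u' t y‖ ^ 2 +
            3 / 2 * ρ t y / θ t y * u t y i * (θ t y - θ' t y) ^ 2) +
          θ t y * (ζ (ρ t y) + ρ t y * deriv ζ (ρ t y)) * (ρ t y - ρ' t y) * (u t y i - u' t y i) +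
          ρ t y * ζ (ρ t y) * (θ t y - θ' t y) * (u t y i - u' t y i)) x =
      1 / 2 * ((θ t x * (ζ (ρ t x) + ρ t x * deriv ζ (ρ t x)) / ρ t x * (2 - 2 / 3 * ζ (ρ t x)) -
            θ t x * (2 * deriv ζ (ρ t x) + ρ t x * deriv (deriv ζ) (ρ t x))) *
          ∑ i, Torus.partialDeriv i (fun y => u t y i) x) * (ρ t x - ρ' t x) ^ 2 +
      1 / 2 * (2 / 3 * ζ (ρ t x) * (3 / 2 * ρ t x / θ t x) *
          ∑ i, Torus.partialDeriv i (fun y => u t y i) x) * (θ t x - θ' t x) ^ 2 +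
      ∑ i, (Torus.partialDeriv i (θ t) x * (ζ (ρ t x) + ρ t x * deriv ζ (ρ t x)) +
            θ t x * (2 * deriv ζ (ρ t x) + ρ t x * deriv (deriv ζ) (ρ t x)) *
              Torus.partialDeriv i (ρ t) x) * (ρ t x - ρ' t x) * (u t x i - u' t x i) +
      ∑ i, (ζ (ρ t x) + ρ t x * deriv ζ (ρ t x)) * Torus.partialDeriv i (ρ t) x *
          (θ t x - θ' t x) * (u t x i - u' t x i) +
      θ t x * (ζ (ρ t x) + ρ t x * deriv ζ (ρ t x)) / ρ t x * (ρ t x - ρ' t x) *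
        -((ρ t x - ρ' t x) * ∑ i, Torus.partialDeriv i (fun y => u' t y i) x +
            ∑ i, (u t x i - u' t x i) * Torus.partialDeriv i (ρ' t) x) +
      ρ t x * ∑ j, (u t x j - u' t x j) *
        -(∑ i, (u t x i - u' t x i) * Torus.partialDeriv i (fun y => u' t y j) x +
            (θ t x * (ζ (ρ t x) + ρ t x * deriv ζ (ρ t x)) / ρ t x -
                θ' t x * (ζ₂ (ρ' t x) + ρ' t x * deriv ζ₂ (ρ' t x)) / ρ' t x) *
              Torus.partialDeriv j (ρ' t) x +
            (ζ (ρ t x) - ζ₂ (ρ' t x)) * Torus.partialDeriv j (θ' t) x) +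
      3 / 2 * ρ t x / θ t x * (θ t x - θ' t x) *
        -(∑ i, (u t x i - u' t x i) * Torus.partialDeriv i (θ' t) x +
            2 / 3 * (θ t x * ζ (ρ t x) - θ' t x * ζ₂ (ρ' t x)) *
              ∑ i, Torus.partialDeriv i (fun y => u' t y i) x) := by
  intro σ σ' T ρ θ ρ' θ' u u' ζ ζ₂ J J₂ hE hE' hJ hJ₂ hζ hζ₂ hρJ hρJ' hp hp' t ht x
  have hU : UniqueDiffOn ℝ (Ico (0 : ℝ) T) := uniqueDiffOn_Ico 0 T
  -- the frozen identity for `W = V - V'`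
  have h := hsEuler_frozen_energy_identity_explicit (α := fun s y => ρ s y - ρ' s y)
    (w := fun s y => u s y - u' s y) (β := fun s y => θ s y - θ' s y) hE hJ hζ hρJ hp
    (hE.smooth_density.sub hE'.smooth_density) (hE.smooth_velocity.sub hE'.smooth_velocity)
    (hE.smooth_temperature.sub hE'.smooth_temperature) ht x
  simp only [PiLp.sub_apply] at h
  refine h.trans ?_
  clear h
  -- derivatives of the differences
  have hρ1 : Torus.IsContDiff 1 (ρ t) := (hE.smooth_density.isSmooth_slice ht).isContDiff (by simp)
  have hθ1 : Torus.IsContDiff 1 (θ t) :=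
    (hE.smooth_temperature.isSmooth_slice ht).isContDiff (by simp)
  have hu1 : Torus.IsContDiff 1 (u t) := (hE.smooth_velocity.isSmooth_slice ht).isContDiff (by simp)
  have hρ1' : Torus.IsContDiff 1 (ρ' t) :=
    (hE'.smooth_density.isSmooth_slice ht).isContDiff (by simp)
  have hθ1' : Torus.IsContDiff 1 (θ' t) :=
    (hE'.smooth_temperature.isSmooth_slice ht).isContDiff (by simp)
  have hu1' : Torus.IsContDiff 1 (u' t) :=
    (hE'.smooth_velocity.isSmooth_slice ht).isContDiff (by simp)
  have hdρ : Torus.timeDerivWithin (Ico 0 T) (fun s y => ρ s y - ρ' s y) t x =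
      Torus.timeDerivWithin (Ico 0 T) ρ t x - Torus.timeDerivWithin (Ico 0 T) ρ' t x :=
    timeDerivWithin_eq_of_hasDerivWithinAt ((hE.smooth_density.hasDerivWithinAt_slice ht x).fun_sub
      (hE'.smooth_density.hasDerivWithinAt_slice ht x)) (hU t ht)
  have hdθ : Torus.timeDerivWithin (Ico 0 T) (fun s y => θ s y - θ' s y) t x =
      Torus.timeDerivWithin (Ico 0 T) θ t x - Torus.timeDerivWithin (Ico 0 T) θ' t x :=
    timeDerivWithin_eq_of_hasDerivWithinAt
      ((hE.smooth_temperature.hasDerivWithinAt_slice ht x).fun_sub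
        (hE'.smooth_temperature.hasDerivWithinAt_slice ht x)) (hU t ht)
  have hdu : ∀ j, Torus.timeDerivWithin (Ico 0 T) (fun s y => u s y j - u' s y j) t x =
      Torus.timeDerivWithin (Ico 0 T) (fun s y => u s y j) t x -
        Torus.timeDerivWithin (Ico 0 T) (fun s y => u' s y j) t x := fun j =>
    timeDerivWithin_eq_of_hasDerivWithinAt
      (((hE.smooth_velocity.apply j).hasDerivWithinAt_slice ht x).fun_sub
        ((hE'.smooth_velocity.apply j).hasDerivWithinAt_slice ht x)) (hU t ht)
  have hgρ : ∀ i, Torus.partialDeriv i (fun y => ρ t y - ρ' t y) x =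
      Torus.partialDeriv i (ρ t) x - Torus.partialDeriv i (ρ' t) x := fun i =>
    partialDeriv_eq_of_hasDerivAt ((hasDerivAt_coordLine hρ1 x i).fun_sub
      (hasDerivAt_coordLine hρ1' x i))
  have hgθ : ∀ i, Torus.partialDeriv i (fun y => θ t y - θ' t y) x =
      Torus.partialDeriv i (θ t) x - Torus.partialDeriv i (θ' t) x := fun i =>
    partialDeriv_eq_of_hasDerivAt ((hasDerivAt_coordLine hθ1 x i).fun_sub
      (hasDerivAt_coordLine hθ1' x i))
  have hgu : ∀ i j, Torus.partialDeriv i (fun y => u t y j - u' t y j) x =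
      Torus.partialDeriv i (fun y => u t y j) x - Torus.partialDeriv i (fun y => u' t y j) x :=
    fun i j => partialDeriv_eq_of_hasDerivAt
      ((hasDerivAt_coordLine (isContDiff_apply_coord hu1 j) x i).fun_sub
        (hasDerivAt_coordLine (isContDiff_apply_coord hu1' j) x i))
  simp only [hdρ, hdθ, hdu, hgρ, hgθ, hgu]
  -- the primitive equations of both solutions
  have hP1 := hsEuler_density_eq hE ht x
  have hP1' := hsEuler_density_eq hE' ht x
  have hP2 := fun k => hsEuler_velocity_eq hE hJ hζ hρJ hp ht x k
  have hP3 := hsEuler_temperature_eq hE hJ hζ hρJ hp ht x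
  have hP3' := hsEuler_temperature_eq hE' hJ₂ hζ₂ hρJ' hp' ht x
  have hρ0 : ρ t x ≠ 0 := (hE.density_pos t ht x).ne'
  have hρ0' : ρ' t x ≠ 0 := (hE'.density_pos t ht x).ne'
  have hV' : ∀ j, Torus.timeDerivWithin (Ico 0 T) (fun s y => u' s y j) t x =
      -(∑ i, u' t x i * Torus.partialDeriv i (fun y => u' t y j) x) -
        (θ' t x * (ζ₂ (ρ' t x) + ρ' t x * deriv ζ₂ (ρ' t x)) / ρ' t x *
            Torus.partialDeriv j (ρ' t) x +
          ζ₂ (ρ' t x) * Torus.partialDeriv j (θ' t) x) := by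
    intro j
    rw [← mul_right_inj' hρ0', hsEuler_velocity_eq hE' hJ₂ hζ₂ hρJ' hp' ht x j]
    field_simp
  have hA : θ t x * (ζ (ρ t x) + ρ t x * deriv ζ (ρ t x)) / ρ t x * ρ t x =
      θ t x * (ζ (ρ t x) + ρ t x * deriv ζ (ρ t x)) := div_mul_cancel₀ _ hρ0
  have hP20 := hP2 0
  have hP21 := hP2 1
  have hP22 := hP2 2
  have hV0 := hV' 0
  have hV1 := hV' 1
  have hV2 := hV' 2
  simp only [Fin.sum_univ_three] at hP1 hP1' hP20 hP21 hP22 hV0 hV1 hV2 hP3 hP3' ⊢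
  linear_combination
    θ t x * (ζ (ρ t x) + ρ t x * deriv ζ (ρ t x)) / ρ t x * (ρ t x - ρ' t x) * hP1 -
    θ t x * (ζ (ρ t x) + ρ t x * deriv ζ (ρ t x)) / ρ t x * (ρ t x - ρ' t x) * hP1' +
    (u t x 0 - u' t x 0) * hP20 + (u t x 1 - u' t x 1) * hP21 + (u t x 2 - u' t x 2) * hP22 -
    ρ t x * (u t x 0 - u' t x 0) * hV0 - ρ t x * (u t x 1 - u' t x 1) * hV1 -
    ρ t x * (u t x 2 - u' t x 2) * hV2 +
    3 / 2 * ρ t x / θ t x * (θ t x - θ' t x) * hP3 -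
    3 / 2 * ρ t x / θ t x * (θ t x - θ' t x) * hP3' +
    ((u t x 0 - u' t x 0) * Torus.partialDeriv 0 (ρ t) x +
      (u t x 1 - u' t x 1) * Torus.partialDeriv 1 (ρ t) x +
      (u t x 2 - u' t x 2) * Torus.partialDeriv 2 (ρ t) x) * hA

end TwoEos

end Summit.AtomisticToContinuum.HydrodynamicLimit.Theorems

end
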